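import Summits.QuantumFields.BalabanUV.Beta.TubeMaximumModulus
import Summits.QuantumFields.BalabanUV.Beta.ConjReflectionAlgebra

/-!
# Beta / VertexToriSymmetry — THE SYMMETRY REDUCTION OF A VERTEX-TORI CERTIFICATE TO A FUNDAMENTAL REGION, in the kernel
# (β sub-cell, BINDER-OWNERS row CAP-k, lineage `b2b-balaban-beta-an5`, gen 22; node BETA-an5-g22-TORI-SYMMETRY, journal l.12243)

Since gen 21 (`Beta/TubeMaximumModulus`) every (Z2)-type binder of the row's anchors is a statement on the `2^{d+1}` VERTEX TORI
`VertexTori w = {|Re q_μ| ≤ π, |Im q_μ| = w_μ ∀μ}`: `hM : ∀ p ∈ VertexTori κ, ‖G p‖ ≤ M` (`CapRowsVertexTori`), `hBa : ∀ p ∈ VertexTori κ,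
‖(A p)⁻¹‖ ≤ Ba` (`CapRouteA`), and the face data of the (Z1) certificate is «`det ≠ 0` on the tori».  Every certificate the cell's engines
price, however, covers only a FUNDAMENTAL REGION of the tori under the symmetries of the integrand — CAP-KERNEL §4.8 (xi) Remark (2) «A₄ mod
symmetry = 5 FACE CLASSES … x sorted increasingly … modulo the residual flip (x, y) ↦ (−x, −y) (fundamental region: u_first + u_last ≤ 0)»
with the paper proofs (P) permutations, (R) single reflections `q_ν ↦ −q_ν`, (C) `f(−q̄) = conj f(q)`; §4.15 (c) «16 vertex tori, 8 classes mod
q ↦ −q̄ and the q₂, q₃ sign flips».  The step «bound on the fundamental region ⟹ bound on all vertex tori» was so far PROSE between the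
certificate and the binder.  This module puts it in the kernel, for an ARBITRARY pointwise predicate `P` (instances: `‖G q‖ ≤ M`,
`‖(A q)⁻¹‖ ≤ B`, `G q ≠ 0`), with every symmetry an EXPLICIT transport hypothesis `P q → P (τ q)`:

* §1 the maps: coordinate reflection `reflectAt ν` (`q_ν ↦ −q_ν`), negation `q ↦ −q`, conjugate reflection `conjNeg` (`q ↦ −q̄`, from
  `Beta/ConjReflectionAlgebra`), coordinate permutation `permute σ` (`q ↦ q ∘ σ`); each maps `VertexTori` to itself.
* §2 the reductions: `of_plusRegion` (reflections in a set `V` of directions ⟹ the region `Im q_ν = +w_ν ∀ ν ∈ V` suffices),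
  `of_negRegion` (negation ⟹ `Im q_{ν₀} = +w_{ν₀}` suffices), `of_conjNegRegion` (`conjNeg` ⟹ the half torus `Re q_{ν₀} ≤ 0` suffices),
  `of_sortedRegion` (all permutations, equal half-widths ⟹ coordinates sorted by `(Im, Re)` lexicographically suffice), and the COMBINED
  region of CAP-KERNEL §4.8 (2) for the symmetric case `of_capRegion` (all reflections + all permutations + `conjNeg` ⟹
  `{Im q_μ = +κ ∀μ, Re q sorted increasingly, Re q_first + Re q_last ≤ 0}` suffices).
* The transports that ARE kernel today (`ConjSymm` ∕ `MatConjSymm`, evenness, table symmetry `K[−R] = K[R]ᵀ`, invariance hypotheses), for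
  scalar integrands AND for matrix families in the Euclidean operator norm (`‖(A q)⁻¹‖`, route A's `hBa`), and the binder-shaped ENDs into
  `TubeHol.norm_le_of_vertexTori` ∕ `stripRegularC_of_vertexTori` are the companion module `Beta.VertexToriSymmetryEnds`.

HONEST FRAMING.  Kernel glue ([folklore] finite combinatorics of signed permutations): WHICH reflections ∕ permutations are symmetries of the
cell's SU(2) δ-axial integrand is NOT asserted here (the transport hypotheses are binders; the paper side is cap3's (P)(R)(C) and cap4's
Lemma G5 table check); no number of the β-function, no certificate, no binder INSTANCE.  Discharging `BetaPertH` would make Bałaban's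
ultraviolet stability unconditional — NOT the continuum limit, NOT the Clay problem.  0 `sorry`, 0 cite tags.
-/

namespace Summit.QuantumFields.BalabanUV.Beta.VertexToriSymmetry

open Complex Set
open Literature.MathematicalPhysics.QuantumFieldTheory.Balaban1983to89
open Beta.AliasingTailL1 (StripRegularC)
open Summit.QuantumFields.BalabanUV.Beta.TubeMaximumModulus
open Summit.QuantumFields.BalabanUV.Beta.ConjReflectionAlgebra (conjNeg conjNeg_apply conjNeg_conjNeg ConjSymm)
open scoped Real ComplexConjugate

noncomputable section

variable {d : ℕ}

/-! ## §1 The symmetry maps and their action on the vertex tori -/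

/-- COORDINATE REFLECTION `q_ν ↦ −q_ν` (cap3's (R)). [folklore] -/
def reflectAt (ν : Fin (d + 1)) (q : Fin (d + 1) → ℂ) : Fin (d + 1) → ℂ := Function.update q ν (-q ν)

/-- the reflected coordinate. [folklore] -/
@[simp] theorem reflectAt_apply_same (ν : Fin (d + 1)) (q : Fin (d + 1) → ℂ) : reflectAt ν q ν = -q ν := by
  simp [reflectAt]

/-- the other coordinates are unchanged. [folklore] -/
@[simp] theorem reflectAt_apply_ne {ν μ : Fin (d + 1)} (h : μ ≠ ν) (q : Fin (d + 1) → ℂ) : reflectAt ν q μ = q μ := by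
  simp [reflectAt, Function.update_of_ne h]

/-- a coordinate reflection is an involution. [folklore] -/
theorem reflectAt_reflectAt (ν : Fin (d + 1)) (q : Fin (d + 1) → ℂ) : reflectAt ν (reflectAt ν q) = q := by
  funext μ
  by_cases h : μ = ν
  · subst h; simp
  · simp [h]

/-- COORDINATE PERMUTATION `q ↦ q ∘ σ` (cap3's (P)). [folklore] -/
def permute (σ : Equiv.Perm (Fin (d + 1))) (q : Fin (d + 1) → ℂ) : Fin (d + 1) → ℂ := fun μ => q (σ μ)

/-- coordinate formula. [folklore] -/
@[simp] theorem permute_apply (σ : Equiv.Perm (Fin (d + 1))) (q : Fin (d + 1) → ℂ) (μ : Fin (d + 1)) :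
    permute σ q μ = q (σ μ) := rfl

/-- `permute σ (permute σ⁻¹ q) = q` (the action is a right action: `permute τ (permute σ q) = permute (τ.trans σ) q`). [folklore] -/
theorem permute_permute_symm (σ : Equiv.Perm (Fin (d + 1))) (q : Fin (d + 1) → ℂ) :
    permute σ (permute σ.symm q) = q := by
  funext μ; simp [permute]

/-- `permute σ⁻¹ (permute σ q) = q`. [folklore] -/
theorem permute_symm_permute (σ : Equiv.Perm (Fin (d + 1))) (q : Fin (d + 1) → ℂ) :
    permute σ.symm (permute σ q) = q := by
  funext μ; simp [permute]

/-- the identity permutation acts trivially. [folklore] -/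
@[simp] theorem permute_one (q : Fin (d + 1) → ℂ) : permute (1 : Equiv.Perm (Fin (d + 1))) q = q := rfl

variable {w : Fin (d + 1) → ℝ} {κ : ℝ}

/-- a coordinate reflection maps the vertex tori to themselves. [folklore] -/
theorem reflectAt_mem_vertexTori (ν : Fin (d + 1)) {q : Fin (d + 1) → ℂ} (hq : q ∈ VertexTori w) :
    reflectAt ν q ∈ VertexTori w := by
  intro μ
  by_cases h : μ = ν
  · subst h; simpa [abs_neg] using hq μ
  · rw [reflectAt_apply_ne h]; exact hq μ

/-- negation maps the vertex tori to themselves. [folklore] -/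
theorem neg_mem_vertexTori {q : Fin (d + 1) → ℂ} (hq : q ∈ VertexTori w) : -q ∈ VertexTori w := by
  intro μ
  simpa [abs_neg] using hq μ

/-- conjugate reflection maps the vertex tori to themselves (it keeps every imaginary part and negates every real part). [folklore] -/
theorem conjNeg_mem_vertexTori {q : Fin (d + 1) → ℂ} (hq : q ∈ VertexTori w) : conjNeg q ∈ VertexTori w := by
  intro μ
  have h := hq μ
  refine ⟨?_, ?_⟩
  · simpa [conjNeg_apply, abs_neg] using h.1
  · simpa [conjNeg_apply] using h.2

/-- real and imaginary parts under conjugate reflection. [folklore] -/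
theorem conjNeg_re (q : Fin (d + 1) → ℂ) (μ : Fin (d + 1)) : (conjNeg q μ).re = -(q μ).re := by simp [conjNeg_apply]

/-- real and imaginary parts under conjugate reflection. [folklore] -/
theorem conjNeg_im (q : Fin (d + 1) → ℂ) (μ : Fin (d + 1)) : (conjNeg q μ).im = (q μ).im := by simp [conjNeg_apply]

/-- with EQUAL half-widths a coordinate permutation maps the vertex tori to themselves. [folklore] -/
theorem permute_mem_vertexTori (σ : Equiv.Perm (Fin (d + 1))) {q : Fin (d + 1) → ℂ}
    (hq : q ∈ VertexTori (fun _ : Fin (d + 1) => κ)) : permute σ q ∈ VertexTori (fun _ : Fin (d + 1) => κ) :=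
  fun μ => hq (σ μ)

/-- on the vertex tori an imaginary part that is not `+w_ν` is `−w_ν`. [folklore] -/
theorem im_eq_neg_of_ne {q : Fin (d + 1) → ℂ} (hq : q ∈ VertexTori w) {ν : Fin (d + 1)} (h : (q ν).im ≠ w ν) :
    (q ν).im = -(w ν) := by
  rcases abs_eq_abs.mp (show |(q ν).im| = |w ν| by rw [(hq ν).2, abs_of_nonneg ((abs_nonneg _).trans_eq (hq ν).2)]) with h1 | h1
  · exact absurd h1 h
  · exact h1

/-! ## §2 The reductions: «`P` on a fundamental region ⟹ `P` on the vertex tori» -/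

section Transport

variable {P : (Fin (d + 1) → ℂ) → Prop}

/-- **REFLECTIONS.**  If `P` is transported along the coordinate reflections of a set `V` of directions, then `P` on the region
`{q ∈ VertexTori w : Im q_ν = +w_ν ∀ ν ∈ V}` gives `P` on all of `VertexTori w` (the `2^{|V|}` sign classes of these directions are
identified; for the scalar U(1) toy of CAP-KERNEL §4.8 `V` = all four directions, for the δ-axial SU(2) integrand §4.15 (c) names `V = {2, 3}`). [folklore] -/
theorem of_plusRegion (V : Finset (Fin (d + 1)))
    (hP : ∀ ν ∈ V, ∀ q ∈ VertexTori w, P q → P (reflectAt ν q))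
    (hreg : ∀ q ∈ VertexTori w, (∀ ν ∈ V, (q ν).im = w ν) → P q) :
    ∀ q ∈ VertexTori w, P q := by
  classical
  induction V using Finset.induction_on generalizing P with
  | empty => exact fun q hq => hreg q hq (by simp)
  | @insert ν₀ V hν₀ ih =>
    refine ih (fun ν hν q hq => hP ν (Finset.mem_insert_of_mem hν) q hq) ?_
    intro q hq hplus
    by_cases h0 : (q ν₀).im = w ν₀
    · exact hreg q hq fun ν hν => by
        rcases Finset.mem_insert.mp hν with rfl | hν
        · exact h0
        · exact hplus ν hν
    · -- reflect the direction `ν₀`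
      have hneg := im_eq_neg_of_ne hq h0
      have hq' : reflectAt ν₀ q ∈ VertexTori w := reflectAt_mem_vertexTori ν₀ hq
      have hP' : P (reflectAt ν₀ q) := by
        refine hreg _ hq' fun ν hν => ?_
        rcases Finset.mem_insert.mp hν with rfl | hν
        · rw [reflectAt_apply_same, neg_im, hneg, neg_neg]
        · have hne : ν ≠ ν₀ := fun e => hν₀ (e ▸ hν)
          rw [reflectAt_apply_ne hne]; exact hplus ν hν
      have := hP ν₀ (Finset.mem_insert_self ν₀ V) _ hq' hP'
      rwa [reflectAt_reflectAt] at this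

/-- **NEGATION.**  If `P` is transported along `q ↦ −q`, then `P` on `{q ∈ VertexTori w : Im q_{ν₀} = +w_{ν₀}}` (any fixed direction `ν₀`)
gives `P` on `VertexTori w` (the sign patterns `s` and `−s` are identified). [folklore] -/
theorem of_negRegion (ν₀ : Fin (d + 1)) (hP : ∀ q ∈ VertexTori w, P q → P (-q))
    (hreg : ∀ q ∈ VertexTori w, (q ν₀).im = w ν₀ → P q) : ∀ q ∈ VertexTori w, P q := by
  intro q hq
  by_cases h0 : (q ν₀).im = w ν₀
  · exact hreg q hq h0
  · have hneg := im_eq_neg_of_ne hq h0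
    have hq' : -q ∈ VertexTori w := neg_mem_vertexTori hq
    have hP' : P (-q) := hreg _ hq' (by rw [Pi.neg_apply, neg_im, hneg, neg_neg])
    have := hP _ hq' hP'
    rwa [neg_neg] at this

/-- **CONJUGATE REFLECTION.**  If `P` is transported along `q ↦ −q̄` (`conjNeg`), then `P` on the half torus
`{q ∈ VertexTori w : Re q_{ν₀} ≤ 0}` (any fixed direction `ν₀`) gives `P` on `VertexTori w` — cap3's «residual flip (x, y) ↦ (−x, −y)». [folklore] -/
theorem of_conjNegRegion (ν₀ : Fin (d + 1)) (hP : ∀ q ∈ VertexTori w, P q → P (conjNeg q))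
    (hreg : ∀ q ∈ VertexTori w, (q ν₀).re ≤ 0 → P q) : ∀ q ∈ VertexTori w, P q := by
  intro q hq
  by_cases h0 : (q ν₀).re ≤ 0
  · exact hreg q hq h0
  · have hq' : conjNeg q ∈ VertexTori w := conjNeg_mem_vertexTori hq
    have hP' : P (conjNeg q) := hreg _ hq' (by rw [conjNeg_re]; linarith [not_le.mp h0])
    have := hP _ hq' hP'
    rwa [conjNeg_conjNeg] at this

/-- the LEXICOGRAPHIC KEY `(Im q_μ, Re q_μ)` by which coordinates are sorted. [folklore] -/
def lexKey (q : Fin (d + 1) → ℂ) (μ : Fin (d + 1)) : ℝ ×ₗ ℝ := toLex ((q μ).im, (q μ).re)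

/-- a momentum is LEX-SORTED if its coordinates are ordered by `(Im, Re)` lexicographically along the index — on the vertex tori: first the
coordinates with `Im = −κ`, by increasing real part, then those with `Im = +κ`, by increasing real part. [folklore] -/
def LexSorted (q : Fin (d + 1) → ℂ) : Prop := Monotone (lexKey q)

/-- the key of a permuted momentum is the permuted key. [folklore] -/
theorem lexKey_permute (σ : Equiv.Perm (Fin (d + 1))) (q : Fin (d + 1) → ℂ) : lexKey (permute σ q) = lexKey q ∘ σ := rfl

/-- every momentum has a sorting permutation (Mathlib's `Tuple.sort`). [folklore] -/
theorem exists_permute_lexSorted (q : Fin (d + 1) → ℂ) : ∃ σ : Equiv.Perm (Fin (d + 1)), LexSorted (permute σ q) :=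
  ⟨Tuple.sort (lexKey q), by rw [LexSorted, lexKey_permute]; exact Tuple.monotone_sort _⟩

/-- **PERMUTATIONS** (equal half-widths).  If `P` is transported along every coordinate permutation, then `P` on the LEX-SORTED points of
`VertexTori κ` gives `P` on `VertexTori κ`. [folklore] -/
theorem of_sortedRegion (hP : ∀ σ : Equiv.Perm (Fin (d + 1)), ∀ q ∈ VertexTori (fun _ : Fin (d + 1) => κ), P q → P (permute σ q))
    (hreg : ∀ q ∈ VertexTori (fun _ : Fin (d + 1) => κ), LexSorted q → P q) :
    ∀ q ∈ VertexTori (fun _ : Fin (d + 1) => κ), P q := by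
  intro q hq
  obtain ⟨σ, hσ⟩ := exists_permute_lexSorted q
  have hq' := permute_mem_vertexTori σ hq
  have := hP σ.symm _ hq' (hreg _ hq' hσ)
  rwa [permute_symm_permute] at this

/-- on the ALL-PLUS torus lex-sortedness is sortedness of the real parts. [folklore] -/
theorem lexSorted_iff_re_of_plus {q : Fin (d + 1) → ℂ} (hplus : ∀ μ, (q μ).im = κ) :
    LexSorted q ↔ Monotone (fun μ => (q μ).re) := by
  constructor
  · intro h μ ν hμν
    have := h hμν
    simp only [lexKey, hplus] at this
    rcases Prod.Lex.toLex_le_toLex.mp this with h1 | ⟨_, h2⟩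
    · exact absurd h1 (lt_irrefl _)
    · exact h2
  · intro h μ ν hμν
    simp only [lexKey, hplus]
    exact Prod.Lex.toLex_le_toLex.mpr (Or.inr ⟨rfl, h hμν⟩)

/-- CAP-KERNEL §4.8 Remark (2)'s FUNDAMENTAL REGION of the vertex tori in the fully symmetric case: all imaginary parts `+κ`, real parts
sorted increasingly along the index, and «u_first + u_last ≤ 0». [folklore] -/
def CapRegion (κ : ℝ) (q : Fin (d + 1) → ℂ) : Prop :=
  (∀ μ, (q μ).im = κ) ∧ Monotone (fun μ => (q μ).re) ∧ (q 0).re + (q (Fin.last d)).re ≤ 0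

/-- reversal of a sorted real tuple after negation is sorted. [folklore] -/
private theorem monotone_neg_rev {x : Fin (d + 1) → ℝ} (hx : Monotone x) : Monotone (fun μ => -x (Fin.rev μ)) :=
  fun _ _ hμν => neg_le_neg (hx (Fin.rev_le_rev.mpr hμν))

/-- **THE COMBINED REDUCTION** (cap3's (P) + (R) + (C), equal half-widths): if `P` is transported along every coordinate reflection, every
coordinate permutation and `conjNeg`, then `P` on `CapRegion κ` gives `P` on all of `VertexTori κ`. [folklore] -/
theorem of_capRegion
    (hPr : ∀ ν, ∀ q ∈ VertexTori (fun _ : Fin (d + 1) => κ), P q → P (reflectAt ν q))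
    (hPσ : ∀ σ : Equiv.Perm (Fin (d + 1)), ∀ q ∈ VertexTori (fun _ : Fin (d + 1) => κ), P q → P (permute σ q))
    (hPc : ∀ q ∈ VertexTori (fun _ : Fin (d + 1) => κ), P q → P (conjNeg q))
    (hreg : ∀ q ∈ VertexTori (fun _ : Fin (d + 1) => κ), CapRegion κ q → P q) :
    ∀ q ∈ VertexTori (fun _ : Fin (d + 1) => κ), P q := by
  -- (R): reduce to the all-plus torus
  refine of_plusRegion Finset.univ (fun ν _ => hPr ν) fun q hq hplus' => ?_
  have hplus : ∀ μ, (q μ).im = κ := fun μ => hplus' μ (Finset.mem_univ μ)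
  -- (P): sort the real parts
  obtain ⟨σ, hσ⟩ := exists_permute_lexSorted q
  set r := permute σ q with hr
  have hr_mem := permute_mem_vertexTori σ hq
  have hr_plus : ∀ μ, (r μ).im = κ := fun μ => hplus (σ μ)
  have hr_mono : Monotone (fun μ => (r μ).re) := (lexSorted_iff_re_of_plus hr_plus).mp hσ
  suffices hPr' : P r by
    have := hPσ σ.symm _ hr_mem hPr'
    simpa only [hr, permute_symm_permute] using this
  by_cases hsum : (r 0).re + (r (Fin.last d)).re ≤ 0
  · exact hreg r hr_mem ⟨hr_plus, hr_mono, hsum⟩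
  · -- (C): flip the real parts and re-sort by the reversal permutation
    set s := permute Fin.revPerm (conjNeg r) with hs
    have hc_mem : conjNeg r ∈ VertexTori (fun _ : Fin (d + 1) => κ) := conjNeg_mem_vertexTori hr_mem
    have hs_mem : s ∈ VertexTori (fun _ : Fin (d + 1) => κ) := permute_mem_vertexTori _ hc_mem
    have hs_re : ∀ μ, (s μ).re = -(r (Fin.rev μ)).re := fun μ => by
      simp only [hs, permute_apply, Fin.revPerm_apply, conjNeg_re]
    have hs_plus : ∀ μ, (s μ).im = κ := fun μ => by
      simp only [hs, permute_apply, Fin.revPerm_apply, conjNeg_im]; exact hr_plus _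
    have hs_mono : Monotone (fun μ => (s μ).re) := by
      have := monotone_neg_rev hr_mono
      refine fun μ ν h => ?_
      show (s μ).re ≤ (s ν).re
      rw [hs_re, hs_re]; exact this h
    have hs_sum : (s 0).re + (s (Fin.last d)).re ≤ 0 := by
      rw [hs_re, hs_re, Fin.rev_zero, Fin.rev_last]
      linarith [not_le.mp hsum]
    have hPs : P s := hreg s hs_mem ⟨hs_plus, hs_mono, hs_sum⟩
    have hPc' : P (conjNeg r) := by
      have := hPσ Fin.revPerm.symm _ hs_mem hPs
      simpa only [hs, permute_symm_permute] using this
    have := hPc _ hc_mem hPc'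
    rwa [conjNeg_conjNeg] at this

end Transport

end

end Summit.QuantumFields.BalabanUV.Beta.VertexToriSymmetry
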